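import Mathlib
import Summits.ValiantsHypothesis.ValiantsHypothesis.Theses.FreeSubtorus
import Summits.ValiantsHypothesis.ValiantsHypothesis.Theorems.FreeSubtorusSubtorusCovering
import Summits.ValiantsHypothesis.ValiantsHypothesis.Cruxes.OrbitDimensionBound.Lines.PowerLadder
import Summits.ValiantsHypothesis.ValiantsHypothesis.Cruxes.OrbitDimensionBound.Lines.RowTorusLadder
import Literature.Computability.AlgebraicComplexity.SymmetricOrbitCircuitEval
import Literature.Computability.AlgebraicComplexity.DetReprEquivalent
import Literature.Computability.AlgebraicComplexity.EquivariantDC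
import Literature.Computability.AlgebraicComplexity.DetInVP

/-!
# `MultipleLadder` — forward rung g11 on the crux `FreeSubtorus.OrbitDimensionBound`

FORWARD GENERATOR G1 (next-rung), unit `fwd2-rung-ValiantsHypothesis-01-g11`.

* FLOOR (proved, `Theorems/FreeSubtorusSubtorusCovering.lean`, `subtorusCovering_proof`):
  `SubtorusCovering` — for `n ≥ 3`, every exactly `T_Λ`-equivariant affine determinantal representation `B` of
  `per_n` of size `m`, `Λ` admissible with `r` generators, has `C(n, ⌊n/2⌋) ≤ m · 2^r`.
* THE DIAL `δ` = the DEGREE OF A COFACTOR: the represented polynomial is a non-zero element `per_n · q`,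
  `deg q ≤ δ`, of the principal IDEAL `(per_n)` instead of `per_n` itself (same variables, same torus `T_Λ`, same
  affine entries, same exact constant lifts — the tree's `IsEquivariantDetRepr` ON THE NOSE, applied to
  `perPoly (Fin n) ℂ * q`).  No equivariance is asked of `q`: it is FORCED (a lift of `γ` gives
  `det B(γ·x) = c_γ · det B(x)`, and `per_n ∘ γ = χ(γ) per_n` is a unit multiple, so `q ∘ γ = c'_γ · q` by unique
  factorisation — `q` is automatically a `T_Λ`-semi-invariant).  `δ = 0` is the floor on the nose
  (`multipleCovering_zero_iff`: a non-zero constant cofactor is rescaled away inside the gauge group, `exists_rescale`).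
* NUMERIC FAMILY `MultipleCovering δ`: such a representation of size `m` has `C(n, ⌊n/2⌋) ≤ (δ+1) · m · 2^r`.
  RUNG (numeric): `AffineMultipleCovering := MultipleCovering 1` (cofactor = a non-zero AFFINE-LINEAR form: by the
  forced semi-invariance and the homotheties inside every admissible `T_Λ`, either a constant or a linear form
  supported on one `T_Λ`-weight class of variables).  The loss factor `δ + 1` is the dial's slack (like the `k` of
  `PowerCovering k`): it is `1` at the floor, and at `δ = 1` it pays for the ONE extra sacrificed pair and for the
  halved terminal bound on the per-invariant torus that the line below needs.
  WHY IT IS NOT A COROLLARY OF THE FLOOR — the floor's proof breaks at three located points: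
  (i) the terminal `r = 0` theorem `BorderApolarityToricWitnessObstructionQP.stub_torusBound` starts from von zur
  Gathen REGULARITY (`isRegular_perPoly vonzurGathen1987_perm_detRepr_rank_holds`, l.278–280 of its file: corank of
  the constant part `≤ 1` because `codim Sing Z(per_n) ≥ 2`), which FAILS for `per_n · ℓ`: the hypersurface
  `Z(per_n · ℓ) = Z(per_n) ∪ Z(ℓ)` is reducible, singular along the codimension-2 locus `Z(per_n) ∩ Z(ℓ)`, and
  `Grenet ⊕ (ℓ)` has a constant part of corank `2`; its weight chain also uses `det = per_n` on the nose
  (`maxGenEigenspace_le_range_of_ne_character … hdet …`, l.319) and an injective member `Ã(P_σ)` on the graph of EVERY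
  `σ` (`per_n(P_σ) = 1`), whereas `(per_n · x_p)(P_σ) = 0` for the `(n-1)!·(n-1)` permutations avoiding `p`;
  (ii) the floor's pair sacrifice (`stub_substPer`, l.223 of the floor file: substitute `1` on `s` sacrificed
  diagonal positions, `0` on the rest of their rows/columns) maps `per_n · q` to `per_{n'} · q|_g`, and `q|_g` may
  VANISH (e.g. `q = x_{(i,l)}` with row `i` sacrificed and `l ≠` its partner) — the sacrifice must be made
  `q`-ABSORBING (generic non-zero diagonal constants, one extra pair, or — in the rigid configuration where no
  spanning matching absorbs `q`, which exists: `r = 1`, `Λ = n(ε_i + ε'_l) - 𝟙`, `q = x_{(i,l)}` — one pinned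
  off-diagonal constant, which costs exactly the per-scaling direction of the free torus); (iii) there is no
  equivariant DIVISION of determinantal
  representations: Strassen / Kaltofen division elimination outputs circuits, and re-determinantalising them
  (Valiant universality) forgets the torus action, while the homotheties in `T_Λ` have no non-zero fixed cofactor
  to divide by equivariantly.  The residual problem after the `q`-absorbing sacrifice is the terminal bound for the
  PER-INVARIANT torus `T¹ = {diag(d_k e_l) : ∏ d ∏ e = 1}` of the free block — the first NON-admissible lattice
  datum (`Λ = 𝟙`, `r = 1`; cf. `NoMinor.noInvariantMinor_ones`, `NoMinor.not_admissible_ones`) — in the half form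
  `2^{n'-1} ≤ m` (skeleton `Lines/affine_multiple.lean`, stubs `stub_cofactorShape`, `stub_absorbingSacrifice`,
  `stub_perInvariantTorusBound`; the expected value `2^{n'} - 1` is what the weight engine of (i) gives when run
  with a generic element `d = (p, 1/∏p)`, `e = (q, 1/∏q)` of `T¹`, regularity being available again since the
  absorbed representation has `det = per_{n'}`).
* SHADOW (the filed rung declaration, asymptotic, implied by the Statement BY NAME): `MultipleShadow δ` — along
  any sequence of admissible `Λ_n`, non-zero cofactors `q_n` of degree `≤ δ` and `T_{Λ_n}`-equivariant affine
  representations `B_n` of `per_n · q_n` of size `m_n`, `n ↦ m_n · 2^{r_n}` is not p-bounded (`δ = 0` is the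
  floor's own shadow `Confusion.CoveringShadow powLoss`, `multipleShadow_zero_iff`, proved: `multipleShadow_zero`).
  `AffineMultipleShadow := MultipleShadow 1`; `affineMultipleShadow_of_summit : ValiantsHypothesis →
  AffineMultipleShadow` is PROVED here (`aesop` safe rule) through a **Kaltofen-free exact DIVISION for circuit
  complexity** (§3, `complexity_le_of_mul`): if `deg g ≤ N` and `q(a) ≠ 0` then
  `L(g) ≤ O(N²) · (L(g·q) + N² · (L(q) + #vars))`, by shifting `a` to the origin, normalising `q̃ = c (1 - w)` with
  `w ∈ 𝔪`, multiplying `g̃ q̃` by the truncated GEOMETRIC series `c⁻¹ (1 + w + ⋯ + w^N)` (`mul_neg_geom_sum`: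
  the error is `g̃ · w^{N+1} ∈ 𝔪^{N+1}`) and cutting above degree `N` with ONE homogeneous-component pass
  (`Power.complexity_sum_homogeneousComponent_le`); a cofactor of degree `≤ δ` has `≤ (n²+1)^δ` monomials, so
  `L(q_n)` is polynomial for fixed `δ` (`complexity_le_of_totalDegree_le`).  For `per_n`: some point with
  `q(a) ≠ 0` exists (`q ≠ 0`, `MvPolynomial.funext`), `N = n`; so a p-bounded sequence of representations of
  multiples `per_n · q_n` makes `PER` p-computable, i.e. `VP_ℂ = VNP_ℂ` (`isPComputable_perPoly_complex_iff`).
  Compare g8's ROOT extraction (binomial series) for the powers dial `per_n ^ k`: the two dials meet only at the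
  floor (`per_n · q = per_n ^ k` forces `k = 1`, `q = 1` by degree in each row), and division replaces roots.
* §4 records how the rung relaxes the open crux: `OrbitMultipleBound δ` (eventually in `n`, symmetrise INTO an
  equivariant representation of SOME non-zero multiple `per_n · q`, `deg q ≤ δ`, of size `≤ m + δ`, budget
  `r ≤ ⌊n/2⌋`; implied by the crux with `q = 1`, and an `∃ B`-statement untouched by the in-place refutations of
  `Cruxes/OrbitDimensionBound/Disproof.lean`), `closes_multiple : OrbitMultipleBound δ → MultipleCovering δ → VH`
  (loss `(δ+1)·(dc+δ) ≤ n · dc` for `n ≥ (δ+1)²`, absorbed by the exponential-`dc` glue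
  `Power.vh_of_eventual_linear_loss`) and `closes_of_orbitDimensionBound : OrbitDimensionBound →
  AffineMultipleCovering → VH`.

Informal sources of the dial: Landsberg–Ressayre pose `edc` for the permanent itself
[cite: LandsbergRessayre2017, Question 2.2, Def. 1.3]; PADDED permanents `ℓ^{m-n} per_n` (multiples by powers of
a linear form) are the objects of geometric complexity theory [cite: Burgisser2024, §1] and of the retired tree
route `UlrichPadded` (no symmetry there); lower bounds for all non-zero multiples of a polynomial — "lower bounds
for principal ideals" — are the theme of Andrews–Forbes (STOC 2022) for constant-depth circuits / IPS
[cite: AndrewsForbes2022, Thm. 1.1]; closure of `VP` under factors is Kaltofen's theorem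
[cite: Burgisser2000, Thm. 2.21 (Kaltofen)] and division elimination is Strassen's [cite: Burgisser2000, Rem. 2.7],
both replaced here by the elementary truncated-geometric-series division for a cofactor with a non-vanishing point.
Everything in this file is PROVED (no `sorry`); the numeric rung `δ = 1` is the content of the registered skeleton
`Lines/affine_multiple.lean`.
-/

open Matrix MvPolynomial Finset
open Literature.Computability.AlgebraicComplexity
open Summit.ValiantsHypothesis.ValiantsHypothesis.Cruxes.OrbitDimensionBound.Degree

-- the mandated summit-side namespace repeats a component by design (single-problem summit)
set_option linter.unusedVariables false
set_option linter.dupNamespace false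

namespace Summit.ValiantsHypothesis.ValiantsHypothesis.Cruxes.OrbitDimensionBound.Multiple

noncomputable section

/-! ## §1 The numeric family `MultipleCovering δ` over the floor -/

/-- **`MultipleCovering δ`** (numeric family, graded by the degree `δ` of the cofactor): for `n ≥ 3`, a
`T_Λ`-equivariant (exact constant lifts) AFFINE determinantal representation `B` of size `m` of a NON-ZERO MULTIPLE
`per_n · q`, `deg q ≤ δ` (an element of the principal ideal `(per_n)` of degree `≤ n + δ`), `Λ` admissible with `r`
generators, has `C(n, ⌊n/2⌋) ≤ m · 2^r`.  `δ = 0` is the floor (`multipleCovering_zero_iff`). -/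
def MultipleCovering (δ : ℕ) : Prop :=
  ∀ n : ℕ, 3 ≤ n → ∀ (m r : ℕ) (Λ : Fin r → (Fin n ⊕ Fin n) → ℤ)
    (B : Matrix (Fin m) (Fin m) (MvPolynomial (Fin n × Fin n) ℂ)) (q : MvPolynomial (Fin n × Fin n) ℂ),
    Admissible n r Λ → q ≠ 0 → q.totalDegree ≤ δ →
    IsEquivariantDetRepr (Subgroup.closure (torusGen n r Λ)) (perPoly (Fin n) ℂ * q) B →
    Nat.choose n (n / 2) ≤ (δ + 1) * (m * 2 ^ r)

/-- **RUNG (numeric) `AffineMultipleCovering`** := `MultipleCovering 1`: multiples of `per_n` by a non-zero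
polynomial of degree `≤ 1`. -/
def AffineMultipleCovering : Prop := MultipleCovering 1

/-- The dial is antitone: a larger cofactor degree is a larger hypothesis class. [folklore] -/
theorem MultipleCovering.anti {δ δ' : ℕ} (hle : δ ≤ δ') (h : MultipleCovering δ') :
    ∀ n : ℕ, 3 ≤ n → ∀ (m r : ℕ) (Λ : Fin r → (Fin n ⊕ Fin n) → ℤ)
      (B : Matrix (Fin m) (Fin m) (MvPolynomial (Fin n × Fin n) ℂ)) (q : MvPolynomial (Fin n × Fin n) ℂ),
      Admissible n r Λ → q ≠ 0 → q.totalDegree ≤ δ →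
      IsEquivariantDetRepr (Subgroup.closure (torusGen n r Λ)) (perPoly (Fin n) ℂ * q) B →
      Nat.choose n (n / 2) ≤ (δ' + 1) * (m * 2 ^ r) :=
  fun n hn m r Λ B q hΛ hq0 hqd hB => h n hn m r Λ B q hΛ hq0 (hqd.trans hle) hB

/-- A representation of `per_n · q` (`n ≥ 1`) has size `m ≥ 1`. [folklore] -/
theorem one_le_size_mul {n m : ℕ} (hn : 1 ≤ n) {Γ : Subgroup (GL (Fin n × Fin n) ℂ)}
    {q : MvPolynomial (Fin n × Fin n) ℂ}
    {B : Matrix (Fin m) (Fin m) (MvPolynomial (Fin n × Fin n) ℂ)}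
    (hB : IsEquivariantDetRepr Γ (perPoly (Fin n) ℂ * q) B) : 1 ≤ m := by
  rcases Nat.eq_zero_or_pos m with h0 | h0
  · subst h0
    exfalso
    have h3 : B.det = 1 := Matrix.det_isEmpty
    have h4 := congrArg constantCoeff hB.1.2
    rw [h3, map_mul, constantCoeff_perPoly ℂ hn, map_one, zero_mul] at h4
    exact one_ne_zero h4
  · exact h0

/-- **Rescaling.**  A `Γ`-equivariant affine representation of `c • f` (`c ≠ 0`, size `m ≥ 1`) yields one of
`f` of the same size (multiply the first row by `c⁻¹`; the lifts are conjugated). [folklore] -/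
theorem exists_rescale {n m : ℕ} {Γ : Subgroup (GL (Fin n × Fin n) ℂ)} {f : MvPolynomial (Fin n × Fin n) ℂ}
    {c : ℂ} (hc : c ≠ 0) {B : Matrix (Fin m) (Fin m) (MvPolynomial (Fin n × Fin n) ℂ)}
    (hB : IsEquivariantDetRepr Γ (c • f) B) (hm : 1 ≤ m) :
    ∃ B' : Matrix (Fin m) (Fin m) (MvPolynomial (Fin n × Fin n) ℂ), IsEquivariantDetRepr Γ f B' := by
  classical
  set i₀ : Fin m := ⟨0, hm⟩
  set d : Fin m → ℂ := fun i => if i = i₀ then c⁻¹ else 1 with hd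
  have hdet : (Matrix.diagonal d).det ≠ 0 := by
    rw [Matrix.det_diagonal]
    refine Finset.prod_ne_zero_iff.2 fun i _ => ?_
    by_cases h : i = i₀
    · simp [hd, h, hc]
    · simp [hd, h]
  set P : GL (Fin m) ℂ := Matrix.GeneralLinearGroup.mkOfDetNeZero (Matrix.diagonal d) hdet with hP
  set B' : Matrix (Fin m) (Fin m) (MvPolynomial (Fin n × Fin n) ℂ) :=
    (P : Matrix (Fin m) (Fin m) ℂ).map C * B * ((1 : GL (Fin m) ℂ) : Matrix (Fin m) (Fin m) ℂ).map C with hB'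
  have hequiv : DetReprEquivalent Γ B B' := detReprEquivalent_mul_mul Γ B P 1
  have hB₁ := isEquivariantDetRepr_iff_exists_mul_mul.1 hB
  refine ⟨B', isEquivariantDetRepr_iff_exists_mul_mul.2 ⟨⟨hequiv.totalDegree_le hB₁.1.1, ?_⟩,
    hequiv.forall_exists_lift hB₁.2⟩⟩
  -- the determinant
  have hPdet : ((P : Matrix (Fin m) (Fin m) ℂ).map C : Matrix (Fin m) (Fin m) (MvPolynomial (Fin n × Fin n) ℂ)).det
      = C c⁻¹ := by
    have h1 : (P : Matrix (Fin m) (Fin m) ℂ) = Matrix.diagonal d := rfl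
    rw [h1, ← RingHom.mapMatrix_apply, ← RingHom.map_det, Matrix.det_diagonal]
    congr 1
    rw [Finset.prod_eq_single i₀]
    · simp [hd]
    · intro i _ hi; simp [hd, hi]
    · intro h; exact absurd (Finset.mem_univ _) h
  rw [hB', Matrix.det_mul, Matrix.det_mul, hPdet, hB.1.2]
  simp only [Units.val_one, Matrix.map_one C C_0 C_1, Matrix.det_one, mul_one]
  rw [smul_eq_C_mul, ← mul_assoc, ← C_mul, inv_mul_cancel₀ hc, C_1, one_mul]

/-- **The floor is the `δ = 0` member** (`q` is then a non-zero constant, removed by `exists_rescale`).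
[cite: LandsbergRessayre2017, Thm. 2.8] -/
theorem multipleCovering_zero_iff :
    MultipleCovering 0 ↔ Summit.ValiantsHypothesis.ValiantsHypothesis.Theses.FreeSubtorus.SubtorusCovering := by
  constructor
  · intro h n hn m r Λ B hΛ hB
    simpa only [zero_add, one_mul] using
      h n hn m r Λ B 1 hΛ one_ne_zero (by simp) (by simpa only [mul_one, torusGen] using hB)
  · intro h n hn m r Λ B q hΛ hq0 hqd hB
    rw [zero_add, one_mul]
    have hqC : q = C (q.coeff 0) := totalDegree_eq_zero_iff_eq_C.1 (Nat.le_zero.1 hqd)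
    have hc : q.coeff 0 ≠ 0 := fun h0 => hq0 (by rw [hqC, h0, C_0])
    have hm : 1 ≤ m := one_le_size_mul (by omega) hB
    have hB₂ : IsEquivariantDetRepr (Subgroup.closure (torusGen n r Λ)) (q.coeff 0 • perPoly (Fin n) ℂ) B := by
      rw [smul_eq_C_mul, mul_comm, ← hqC]; exact hB
    obtain ⟨B', hB'⟩ := exists_rescale hc hB₂ hm
    exact h n hn m r Λ B' hΛ (by simpa only [torusGen] using hB')

/-- Hence `MultipleCovering 0` is a theorem (the floor, `subtorusCovering_proof`). [cite: LandsbergRessayre2017, Thm. 2.8] -/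
theorem multipleCovering_zero : MultipleCovering 0 :=
  multipleCovering_zero_iff.mpr
    Summit.ValiantsHypothesis.ValiantsHypothesis.Theorems.FreeSubtorusSubtorusCovering.subtorusCovering_proof

/-- The numeric rung implies the floor up to its loss factor `2`: `C(n,⌊n/2⌋) ≤ 2 · m · 2^r` for equivariant
representations of `per_n` itself. [folklore] -/
theorem halfCovering_of_affineMultipleCovering (h : AffineMultipleCovering) :
    ∀ n : ℕ, 3 ≤ n → ∀ (m r : ℕ) (Λ : Fin r → (Fin n ⊕ Fin n) → ℤ)
      (B : Matrix (Fin m) (Fin m) (MvPolynomial (Fin n × Fin n) ℂ)), Admissible n r Λ →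
      IsEquivariantDetRepr (Subgroup.closure (torusGen n r Λ)) (perPoly (Fin n) ℂ) B →
      Nat.choose n (n / 2) ≤ 2 * (m * 2 ^ r) :=
  fun n hn m r Λ B hΛ hB => MultipleCovering.anti (Nat.zero_le 1) h n hn m r Λ B 1 hΛ one_ne_zero (by simp)
    (by simpa only [mul_one] using hB)

/-! ## §2 The shadow `MultipleShadow δ` (filed rung declaration = `AffineMultipleShadow`) -/

/-- **`MultipleShadow δ`** (asymptotic shadow of `MultipleCovering δ`, in the floor's gauge): along any sequence
of admissible `Λ_n`, non-zero cofactors `q_n` of degree `≤ δ` and `T_{Λ_n}`-equivariant affine determinantal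
representations `B_n` of `per_n · q_n` of sizes `m_n` (`n ≥ 3`), the function `n ↦ m_n · 2^{r_n}` is not
p-bounded. [cite: LandsbergRessayre2017, Question 2.2] [cite: Burgisser2000, Def. 2.1] -/
def MultipleShadow (δ : ℕ) : Prop :=
  ∀ (m r : ℕ → ℕ) (Λ : (n : ℕ) → Fin (r n) → (Fin n ⊕ Fin n) → ℤ)
    (q : (n : ℕ) → MvPolynomial (Fin n × Fin n) ℂ)
    (B : (n : ℕ) → Matrix (Fin (m n)) (Fin (m n)) (MvPolynomial (Fin n × Fin n) ℂ)),
    (∀ n : ℕ, 3 ≤ n → Admissible n (r n) (Λ n) ∧ q n ≠ 0 ∧ (q n).totalDegree ≤ δ ∧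
      IsEquivariantDetRepr (Subgroup.closure (torusGen n (r n) (Λ n))) (perPoly (Fin n) ℂ * q n) (B n)) →
    ¬ IsPBounded (fun n => m n * 2 ^ (r n))

/-- **RUNG DECLARATION `AffineMultipleShadow`** := `MultipleShadow 1`. -/
def AffineMultipleShadow : Prop := MultipleShadow 1

/-- Shadows are antitone in `δ`. [folklore] -/
theorem MultipleShadow.anti {δ δ' : ℕ} (hle : δ ≤ δ') (h : MultipleShadow δ') : MultipleShadow δ :=
  fun m r Λ q B hyp => h m r Λ q B fun n hn =>
    ⟨(hyp n hn).1, (hyp n hn).2.1, (hyp n hn).2.2.1.trans hle, (hyp n hn).2.2.2⟩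

/-- **Numeric rung ⇒ shadow** (the middle binomial coefficient is not p-bounded). [folklore] -/
theorem multipleShadow_of_multipleCovering {δ : ℕ} (h : MultipleCovering δ) : MultipleShadow δ := by
  intro m r Λ q B hyp hPB
  have hPB' : IsPBounded (fun n => (δ + 1) * (m n * 2 ^ (r n))) := IsPBounded.mul_holds (IsPBounded.const _) hPB
  refine not_isPBounded_choose_middle (IsPBounded.of_eventually_le 3 hPB' fun n hn => ?_)
  obtain ⟨hΛ, hq0, hqd, hB⟩ := hyp n hn
  exact h n hn (m n) (r n) (Λ n) (B n) (q n) hΛ hq0 hqd hB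

/-- `AffineMultipleCovering ⇒ AffineMultipleShadow`. [folklore] -/
theorem affineMultipleShadow_of_affineMultipleCovering (h : AffineMultipleCovering) : AffineMultipleShadow :=
  multipleShadow_of_multipleCovering h

/-- **At `δ = 0` the shadow IS the floor's shadow** `CoveringShadow powLoss` (rescaling). [folklore] -/
theorem multipleShadow_zero_iff : MultipleShadow 0 ↔ Confusion.CoveringShadow Confusion.powLoss := by
  constructor
  · intro h m r Λ B hyp
    refine h m r Λ (fun _ => 1) B fun n hn => ⟨(hyp n hn).1, one_ne_zero, by simp, ?_⟩
    simpa only [mul_one, torusGen] using (hyp n hn).2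
  · intro h m r Λ q B hyp
    classical
    have key : ∀ n : ℕ, 3 ≤ n → ∃ B' : Matrix (Fin (m n)) (Fin (m n)) (MvPolynomial (Fin n × Fin n) ℂ),
        IsEquivariantDetRepr (Subgroup.closure (torusGen n (r n) (Λ n))) (perPoly (Fin n) ℂ) B' := by
      intro n hn
      obtain ⟨-, hq0, hqd, hB⟩ := hyp n hn
      have hqC : q n = C ((q n).coeff 0) := totalDegree_eq_zero_iff_eq_C.1 (Nat.le_zero.1 hqd)
      have hc : (q n).coeff 0 ≠ 0 := fun h0 => hq0 (by rw [hqC, h0, C_0])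
      have hm : 1 ≤ m n := one_le_size_mul (by omega) hB
      have hB₂ : IsEquivariantDetRepr (Subgroup.closure (torusGen n (r n) (Λ n)))
          ((q n).coeff 0 • perPoly (Fin n) ℂ) (B n) := by
        rw [smul_eq_C_mul, mul_comm, ← hqC]; exact hB
      exact exists_rescale hc hB₂ hm
    let B' : (n : ℕ) → Matrix (Fin (m n)) (Fin (m n)) (MvPolynomial (Fin n × Fin n) ℂ) := fun n =>
      if hn : 3 ≤ n then (key n hn).choose else B n
    refine h m r Λ B' fun n hn => ⟨(hyp n hn).1, ?_⟩
    have e : B' n = (key n hn).choose := dif_pos hn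
    rw [e]
    simpa only [torusGen] using (key n hn).choose_spec

/-- The floor's shadow at `δ = 0`, unconditionally. [cite: LandsbergRessayre2017, Thm. 2.8] -/
theorem multipleShadow_zero : MultipleShadow 0 := multipleShadow_zero_iff.mpr RowTorus.powShadow_floor

/-- Rung ⇒ floor shadow (shadow currency). [folklore] -/
theorem powShadow_of_affineMultipleShadow (h : AffineMultipleShadow) :
    Confusion.CoveringShadow Confusion.powLoss :=
  multipleShadow_zero_iff.mp (MultipleShadow.anti (Nat.zero_le 1) h)

/-! ## §3 `S ⇒ MultipleShadow δ` — exact division by a low-degree unit (Kaltofen-free)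

Strassen's division elimination in the only case needed here: if `p = g · q` with `q(a) ≠ 0` and `deg g ≤ N`,
shift to `a = 0`, normalise `q` to `u = 1 - w` with `w ∈ 𝔪`, and read `g` off the degree-`≤ N` part of
`p · c⁻¹ · (1 + w + ⋯ + w^N)`, because `g - p c⁻¹ (1 + ⋯ + w^N) = g · w^{N+1} ∈ 𝔪^{N+1}`.  Together with the
sparse bound `L(q) ≤ (|σ|+1)^δ (2δ+2)` for `deg q ≤ δ` this gives `L(per_n) ≤ poly_δ(n) · (L(per_n q) + 1)`.
[cite: Burgisser2000, Thm. 2.21, Rem. 2.7] -/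

section Division

variable {σ : Type*}

/-- The truncated geometric series `1 + X + ⋯ + X^N`. [folklore] -/
def geomPoly (N : ℕ) : Polynomial ℂ := ∑ i ∈ range (N + 1), Polynomial.X ^ i

theorem natDegree_geomPoly_lt (N : ℕ) : (geomPoly N).natDegree < N + 1 := by
  unfold geomPoly
  refine Nat.lt_succ_of_le (Polynomial.natDegree_sum_le_of_forall_le _ _ fun i hi => ?_)
  rw [Polynomial.natDegree_X_pow]
  exact Nat.lt_succ_iff.1 (Finset.mem_range.1 hi)

theorem aeval_geomPoly (N : ℕ) (w : MvPolynomial σ ℂ) :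
    Polynomial.aeval w (geomPoly N) = ∑ i ∈ range (N + 1), w ^ i := by
  simp [geomPoly, map_sum, map_pow, Polynomial.aeval_X]

/-- `L(monomial s c) ≤ 2 |s| + 1`. [folklore] -/
theorem complexity_monomial_le (s : σ →₀ ℕ) (c : ℂ) :
    complexity (monomial s c) ≤ 2 * s.degree + 1 := by
  classical
  rw [monomial_eq]
  have hprod : complexity (s.prod fun i e => (X i : MvPolynomial σ ℂ) ^ e) ≤ s.degree + s.degree := by
    rw [Finsupp.prod]
    refine (complexity_finset_prod_le s.support _).trans ?_
    have h1 : ∑ i ∈ s.support, complexity ((X i : MvPolynomial σ ℂ) ^ s i) ≤ s.degree := by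
      rw [Finsupp.degree_apply]
      refine Finset.sum_le_sum fun i _ => ?_
      have h := Power.complexity_pow_le' (σ := σ) (X i) (s i)
      rw [complexity_X_holds] at h
      simpa using h
    have h2 : s.support.card ≤ s.degree := by
      rw [Finsupp.degree_apply, Finset.card_eq_sum_ones]
      exact Finset.sum_le_sum fun i hi => Nat.one_le_iff_ne_zero.2 (Finsupp.mem_support_iff.1 hi)
    omega
  calc complexity (C c * s.prod fun i e => (X i : MvPolynomial σ ℂ) ^ e)
      ≤ complexity (C c : MvPolynomial σ ℂ) + complexity (s.prod fun i e => (X i : MvPolynomial σ ℂ) ^ e) + 1 :=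
        complexity_mul_le_holds _ _
    _ ≤ 2 * s.degree + 1 := by rw [complexity_C_holds]; omega

variable [Fintype σ]

/-- **Sparse bound**: `deg q ≤ δ ⇒ L(q) ≤ (|σ|+1)^δ · (2δ+2)` (write `q` as the sum of its `≤ (|σ|+1)^δ` monomials).
[folklore] -/
theorem complexity_le_of_totalDegree_le [DecidableEq σ] (q : MvPolynomial σ ℂ) {δ : ℕ}
    (hq : q.totalDegree ≤ δ) : complexity q ≤ (Fintype.card σ + 1) ^ δ * (2 * δ + 2) := by
  classical
  have hcard : q.support.card ≤ (Fintype.card σ + 1) ^ δ :=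
    OrbitCircuit.card_support_le_of_totalDegree_le q hq
  have hsum := complexity_sum_le_of_le q.support (fun s => monomial s (coeff s q)) (2 * δ + 1)
    (fun s hs => (complexity_monomial_le s _).trans (by
      have hdeg : s.degree ≤ δ := by
        have e : s.degree = s.sum fun _ e => e := by simp [Finsupp.degree, Finsupp.sum]
        rw [e]; exact (le_totalDegree hs).trans hq
      omega))
  conv_lhs => rw [as_sum q]
  calc complexity (∑ v ∈ q.support, monomial v (coeff v q))
      ≤ q.support.card * (2 * δ + 1) + q.support.card := hsum
    _ = q.support.card * (2 * δ + 2) := by ring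
    _ ≤ (Fintype.card σ + 1) ^ δ * (2 * δ + 2) := Nat.mul_le_mul_right _ hcard

/-- **Exact division by a unit of the local ring (Kaltofen-free).**  If `deg g ≤ N` and `q(a) ≠ 0` then
`L(g) ≤ (N+2)² · (L(g q) + |σ| + 2 + (N+1)((N+1)(L(q) + |σ| + 4) + 1) + (N+1)) + (N+1) + |σ|`.
[cite: Burgisser2000, Thm. 2.21 (Strassen's Vermeidung von Divisionen)] -/
theorem complexity_le_of_mul (g q : MvPolynomial σ ℂ) (a : σ → ℂ) (ha : eval a q ≠ 0) {N : ℕ}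
    (hN : g.totalDegree ≤ N) :
    complexity g ≤ (N + 2) ^ 2 * (complexity (g * q) + Fintype.card σ + 2 +
        ((N + 1) * ((N + 1) * (complexity q + Fintype.card σ + 4) + 1) + (N + 1))) + (N + 1) + Fintype.card σ := by
  -- the shift
  set sh : σ → MvPolynomial σ ℂ := fun i => X i + C (a i) with hsh_def
  set ush : σ → MvPolynomial σ ℂ := fun i => X i - C (a i) with hush_def
  set c : ℂ := eval a q with hc_def
  set gt : MvPolynomial σ ℂ := aeval sh g with hgt_def
  set qt : MvPolynomial σ ℂ := aeval sh q with hqt_def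
  have hqt0 : constantCoeff qt = c := by
    have h1 : aeval (0 : σ → ℂ) qt = aeval (fun i => aeval (0 : σ → ℂ) (sh i)) q :=
      comp_aeval_apply sh (aeval (0 : σ → ℂ)) q
    have h2 : (fun i => aeval (0 : σ → ℂ) (sh i)) = a := by
      funext i; simp [hsh_def]
    rw [h2] at h1
    rw [← eval_zero]
    exact h1
  have hunshift : aeval ush gt = g := by
    rw [hgt_def, comp_aeval_apply]
    have : (fun i => aeval ush (sh i)) = X := by
      funext i; simp [hsh_def, hush_def]
    rw [this, aeval_X_left, AlgHom.id_apply]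
  have hgtdeg : gt.totalDegree ≤ N :=
    (Literature.RingTheory.MvPolynomial.totalDegree_aeval_le_of_le_one sh
      (fun i => (totalDegree_add _ _).trans (by rw [totalDegree_X, totalDegree_C]; simp)) g).trans hN
  -- normalise the constant term of the divisor
  set u : MvPolynomial σ ℂ := c⁻¹ • qt with hu_def
  have hu1 : constantCoeff u = 1 := by
    rw [hu_def, constantCoeff_smul, hqt0, smul_eq_mul, inv_mul_cancel₀ ha]
  set w : MvPolynomial σ ℂ := 1 - u with hw_def
  have hw : w ∈ idealOfVars σ ℂ := Power.mem_idealOfVars_of_constantCoeff (by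
    rw [hw_def, map_sub, map_one, hu1, sub_self])
  -- the truncated inverse and the candidate quotient
  set G : MvPolynomial σ ℂ := Polynomial.aeval w (geomPoly N) with hG_def
  have hgeom : u * G = 1 - w ^ (N + 1) := by
    rw [hG_def, aeval_geomPoly, show u = 1 - w by rw [hw_def, sub_sub_cancel], mul_neg_geom_sum]
  set A : MvPolynomial σ ℂ := c⁻¹ • aeval sh (g * q) * G with hA_def
  have hA : gt - A = gt * w ^ (N + 1) := by
    have h1 : c⁻¹ • aeval sh (g * q) = gt * u := by
      rw [map_mul, hu_def, mul_smul_comm]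
    rw [hA_def, h1, mul_assoc, hgeom]; ring
  have hmem : A - gt ∈ idealOfVars σ ℂ ^ (N + 1) := by
    rw [← neg_sub, hA]
    exact neg_mem (Ideal.mul_mem_left _ _ (Ideal.pow_mem_pow hw _))
  set P : MvPolynomial σ ℂ := ∑ d ∈ range (N + 1), homogeneousComponent d A with hP_def
  have hP : P = gt := by
    rw [hP_def, Power.sum_homogeneousComponent_congr hmem, Power.sum_homogeneousComponent_of_le gt hgtdeg]
  have hg_eq : aeval ush P = g := by rw [hP, hunshift]
  -- complexity bookkeeping
  have hsh_sum : ∑ i, complexity (sh i) ≤ Fintype.card σ := by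
    calc ∑ i, complexity (sh i) ≤ ∑ _i : σ, 1 := Finset.sum_le_sum fun i _ => Power.complexity_X_add_C_le i (a i)
      _ = Fintype.card σ := by simp
  have hush_sum : ∑ i, complexity (ush i) ≤ Fintype.card σ := by
    calc ∑ i, complexity (ush i) ≤ ∑ _i : σ, 1 := Finset.sum_le_sum fun i _ => by
            have h := Power.complexity_sub_C_le (X i : MvPolynomial σ ℂ) (a i)
            rw [complexity_X_holds] at h
            simpa [hush_def] using h
      _ = Fintype.card σ := by simp
  have hLp : complexity (c⁻¹ • aeval sh (g * q)) ≤ complexity (g * q) + Fintype.card σ + 1 := by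
    have h1 : complexity (aeval sh (g * q)) ≤ complexity (g * q) + Fintype.card σ :=
      (complexity_aeval_le _ _).trans (by omega)
    exact (complexity_smul_le_holds _ _).trans (by omega)
  have hLu : complexity u ≤ complexity q + Fintype.card σ + 1 := by
    have h1 : complexity qt ≤ complexity q + Fintype.card σ := (complexity_aeval_le _ _).trans (by omega)
    exact (complexity_smul_le_holds _ _).trans (by omega)
  have hLw : complexity w ≤ complexity q + Fintype.card σ + 3 := by
    have e : w = C 1 + (-1 : ℂ) • u := by rw [hw_def, neg_one_smul, C_1, sub_eq_add_neg]
    rw [e]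
    calc complexity (C 1 + (-1 : ℂ) • u) ≤ complexity (C 1 : MvPolynomial σ ℂ) + complexity ((-1 : ℂ) • u) + 1 :=
          complexity_add_le_holds _ _
      _ ≤ 0 + (complexity u + 1) + 1 := by rw [complexity_C_holds]; gcongr; exact complexity_smul_le_holds _ _
      _ ≤ complexity q + Fintype.card σ + 3 := by omega
  set W : ℕ := complexity w + 1 with hW_def
  have hW : W ≤ complexity q + Fintype.card σ + 4 := by omega
  have hLG : complexity G ≤ (N + 1) * ((N + 1) * W + 1) + (N + 1) :=
    Power.complexity_polynomial_aeval_le (natDegree_geomPoly_lt N) w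
  have hLA : complexity A ≤ complexity (c⁻¹ • aeval sh (g * q)) + complexity G + 1 := complexity_mul_le_holds _ _
  have hLP : complexity P ≤ (N + 2) ^ 2 * complexity A + (N + 1) := complexity_sum_homogeneousComponent_le A N
  have hLg : complexity g ≤ complexity P + Fintype.card σ := by
    conv_lhs => rw [← hg_eq]
    exact (complexity_aeval_le _ _).trans (by omega)
  set LA : ℕ := complexity A with hLA_def
  set LG : ℕ := complexity G with hLG_def
  calc complexity g ≤ (N + 2) ^ 2 * LA + (N + 1) + Fintype.card σ := by omega
    _ ≤ (N + 2) ^ 2 * (complexity (g * q) + Fintype.card σ + 2 + LG) + (N + 1) + Fintype.card σ := by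
        gcongr; omega
    _ ≤ (N + 2) ^ 2 * (complexity (g * q) + Fintype.card σ + 2 + ((N + 1) * ((N + 1) * W + 1) + (N + 1)))
          + (N + 1) + Fintype.card σ := by gcongr
    _ ≤ (N + 2) ^ 2 * (complexity (g * q) + Fintype.card σ + 2 +
          ((N + 1) * ((N + 1) * (complexity q + Fintype.card σ + 4) + 1) + (N + 1))) + (N + 1) + Fintype.card σ := by
        gcongr

end Division

/-! ### Application to the permanent -/

/-- The polynomial bound `F_δ(n, E)` on `L(per_n)` in terms of `E ≥ L(per_n · q)`, `deg q ≤ δ`. -/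
def divBound (δ n E : ℕ) : ℕ :=
  (n + 2) ^ 2 * (E + n * n + 2 +
    ((n + 1) * ((n + 1) * ((n * n + 1) ^ δ * (2 * δ + 2) + n * n + 4) + 1) + (n + 1))) + (n + 1) + n * n

theorem divBound_mono (δ n : ℕ) {E E' : ℕ} (h : E ≤ E') : divBound δ n E ≤ divBound δ n E' := by
  unfold divBound; gcongr

/-- Division for the permanent: `L(per_n) ≤ F_δ(n, L(per_n · q))` for `q ≠ 0`, `deg q ≤ δ`. [cite: Burgisser2000, Thm. 2.21] -/
theorem complexity_perPoly_le_of_mul (n δ : ℕ) (q : MvPolynomial (Fin n × Fin n) ℂ) (hq0 : q ≠ 0)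
    (hqd : q.totalDegree ≤ δ) :
    complexity (perPoly (Fin n) ℂ) ≤ divBound δ n (complexity (perPoly (Fin n) ℂ * q)) := by
  classical
  -- a point where `q` does not vanish
  obtain ⟨a, ha⟩ : ∃ a : Fin n × Fin n → ℂ, eval a q ≠ 0 := by
    by_contra! h
    exact hq0 (MvPolynomial.funext fun x => by rw [h x, map_zero])
  have hN : (perPoly (Fin n) ℂ).totalDegree ≤ n :=
    perPoly_isHomogeneous.totalDegree_le.trans (by rw [Fintype.card_fin])
  have h := complexity_le_of_mul (perPoly (Fin n) ℂ) q a ha hN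
  have hLq : complexity q ≤ (n * n + 1) ^ δ * (2 * δ + 2) := by
    simpa only [Fintype.card_prod, Fintype.card_fin] using complexity_le_of_totalDegree_le q hqd
  simp only [Fintype.card_prod, Fintype.card_fin] at h
  refine h.trans ?_
  unfold divBound
  gcongr

/-- `F_δ(n, E(n))` is p-bounded when `E` is. [folklore] -/
theorem isPBounded_divBound (δ : ℕ) {E : ℕ → ℕ} (hE : IsPBounded E) :
    IsPBounded (fun n => divBound δ n (E n)) := by
  have hn1 : IsPBounded (fun n : ℕ => n + 1) := IsPBounded.add_holds IsPBounded.id (IsPBounded.const 1)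
  have hn2 : IsPBounded (fun n : ℕ => n + 2) := IsPBounded.add_holds IsPBounded.id (IsPBounded.const 2)
  have hnn : IsPBounded (fun n : ℕ => n * n) := IsPBounded.mul_holds IsPBounded.id IsPBounded.id
  have hQ : IsPBounded (fun n : ℕ => (n * n + 1) ^ δ * (2 * δ + 2) + n * n + 4) :=
    IsPBounded.add_holds (IsPBounded.add_holds
      (IsPBounded.mul_holds (IsPBounded.pow_holds (IsPBounded.add_holds hnn (IsPBounded.const 1)) δ)
        (IsPBounded.const (2 * δ + 2))) hnn) (IsPBounded.const 4)
  have h1 : IsPBounded (fun n : ℕ => (n + 1) * ((n * n + 1) ^ δ * (2 * δ + 2) + n * n + 4) + 1) :=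
    IsPBounded.add_holds (IsPBounded.mul_holds hn1 hQ) (IsPBounded.const 1)
  have h2 : IsPBounded (fun n : ℕ => (n + 1) * ((n + 1) * ((n * n + 1) ^ δ * (2 * δ + 2) + n * n + 4) + 1) + (n + 1)) :=
    IsPBounded.add_holds (IsPBounded.mul_holds hn1 h1) hn1
  have h3 : IsPBounded (fun n : ℕ => E n + n * n + 2 +
      ((n + 1) * ((n + 1) * ((n * n + 1) ^ δ * (2 * δ + 2) + n * n + 4) + 1) + (n + 1))) :=
    IsPBounded.add_holds (IsPBounded.add_holds (IsPBounded.add_holds hE hnn) (IsPBounded.const 2)) h2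
  have h4 := IsPBounded.add_holds (IsPBounded.add_holds (IsPBounded.mul_holds (IsPBounded.pow_holds hn2 2) h3) hn1) hnn
  exact h4

/-- **ON-PATH LEMMA `S → MultipleShadow δ`** (every `δ`): a p-bounded sequence of affine representations of
`per_n · q_n` gives `L(per_n · q_n) ≤ 8(m_n+1)^7 + m_n²(2n²+1)` p-bounded, hence (exact division by the unit
`q_n`, `deg q_n ≤ δ`) `L(per_n)` p-bounded, i.e. `PER` is p-computable, i.e. `VP_ℂ = VNP_ℂ`
(`isPComputable_perPoly_complex_iff`). [cite: Burgisser2000, Rem. 2.11, Thm. 2.10, Thm. 2.21] -/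
theorem multipleShadow_of_summit (δ : ℕ) (hS : _root_.ValiantsHypothesis) : MultipleShadow δ := by
  intro m r Λ q B hyp hPB
  have hm : IsPBounded m :=
    IsPBounded.of_eventually_le 0 hPB fun n _ => Nat.le_mul_of_pos_right _ Nat.one_le_two_pow
  have hnn : IsPBounded (fun n : ℕ => n * n) := IsPBounded.mul_holds IsPBounded.id IsPBounded.id
  have hE : IsPBounded (fun n => 8 * (m n + 1) ^ 7 + m n ^ 2 * (2 * (n * n) + 1)) :=
    IsPBounded.add_holds
      (IsPBounded.mul_holds (IsPBounded.const 8) (IsPBounded.pow_holds (IsPBounded.add_holds hm (IsPBounded.const 1)) 7))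
      (IsPBounded.mul_holds (IsPBounded.pow_holds hm 2)
        (IsPBounded.add_holds (IsPBounded.mul_holds (IsPBounded.const 2) hnn) (IsPBounded.const 1)))
  have hF := isPBounded_divBound δ hE
  have hL : IsPComputable (fun n => perPoly (Fin n) ℂ) := by
    refine IsPBounded.of_eventually_le 3 hF fun n hn => ?_
    obtain ⟨-, hq0, hqd, hrep⟩ := hyp n hn
    have hdet : (B n).det = perPoly (Fin n) ℂ * q n := hrep.1.2
    have hEq : complexity (perPoly (Fin n) ℂ * q n) ≤ 8 * (m n + 1) ^ 7 + m n ^ 2 * (2 * (n * n) + 1) := by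
      rw [← hdet]
      refine (complexity_det_le (B n)).trans ?_
      have h8 := complexity_detPoly_le ℂ (m n)
      have hs := sum_complexity_le_of_affine hrep.1.1
      omega
    show complexity (perPoly (Fin n) ℂ) ≤ _
    exact (complexity_perPoly_le_of_mul n δ (q n) hq0 hqd).trans (divBound_mono δ n hEq)
  exact hS (isPComputable_perPoly_complex_iff.1 hL)

/-- **`S → AffineMultipleShadow`** (the rung's on-path lemma, by name; `aesop` safe rule for the tribunal kernel).
[cite: Burgisser2000, Thm. 2.21] -/
@[aesop safe apply]
theorem affineMultipleShadow_of_summit (hS : _root_.ValiantsHypothesis) : AffineMultipleShadow :=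
  multipleShadow_of_summit 1 hS

/-- Same, under the F-protocol name `<Rung>_of_ValiantsHypothesis`. [cite: Burgisser2000, Thm. 2.21] -/
@[aesop safe apply]
theorem AffineMultipleShadow_of_ValiantsHypothesis : _root_.ValiantsHypothesis → AffineMultipleShadow :=
  affineMultipleShadow_of_summit

/-! ## §4 How the rung relaxes the open crux `OrbitDimensionBound` -/

/-- **`OrbitMultipleBound δ`** — the symmetrisation target RELAXED by the rung: eventually in `n`, every affine
determinantal representation `A` of `per_n` of size `m` can be replaced by a `T_Λ`-equivariant (exact constant
lifts) affine representation `B`, of size `≤ m + δ`, of SOME NON-ZERO MULTIPLE `per_n · q` with `deg q ≤ δ`, for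
some admissible `Λ` of rank `r ≤ ⌊n/2⌋` (the host crux's own budget).  Implied by `OrbitDimensionBound`
(`q = 1`, `orbitMultipleBound_of_orbitDimensionBound`), not conversely: padding `A` by `δ` affine-linear
diagonal entries (or any other way of landing in the ideal `(per_n)`) before symmetrising is extra freedom that
the rung pays for.  Like the host crux it is an `∃ B`-statement, so the in-place refutations of
`Cruxes/OrbitDimensionBound/Disproof.lean` do not touch it. [cite: LandsbergRessayre2017, Question 2.2, §6] -/
def OrbitMultipleBound (δ : ℕ) : Prop :=
  ∃ n₀ : ℕ, ∀ n : ℕ, n₀ ≤ n → ∀ (m : ℕ) (A : Matrix (Fin m) (Fin m) (MvPolynomial (Fin n × Fin n) ℂ)),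
    IsAffineDetRepr (perPoly (Fin n) ℂ) A →
    ∃ (m' : ℕ) (B : Matrix (Fin m') (Fin m') (MvPolynomial (Fin n × Fin n) ℂ))
      (q : MvPolynomial (Fin n × Fin n) ℂ) (r : ℕ) (Λ : Fin r → (Fin n ⊕ Fin n) → ℤ),
      m' ≤ m + δ ∧ q ≠ 0 ∧ q.totalDegree ≤ δ ∧ r ≤ n / 2 ∧ Admissible n r Λ ∧
      IsEquivariantDetRepr (Subgroup.closure (torusGen n r Λ)) (perPoly (Fin n) ℂ * q) B

/-- The host crux implies the relaxed one (`q = 1`, same matrix). [cite: LandsbergRessayre2017, Question 2.2] -/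
theorem orbitMultipleBound_of_orbitDimensionBound (δ : ℕ)
    (h : Summit.ValiantsHypothesis.ValiantsHypothesis.Theses.FreeSubtorus.OrbitDimensionBound) :
    OrbitMultipleBound δ := by
  refine ⟨3, fun n hn m A hA => ?_⟩
  obtain ⟨B, r, Λ, hr, hΛ, hB⟩ := h n hn m A hA
  refine ⟨m, B, 1, r, Λ, Nat.le_add_right _ _, one_ne_zero, by simp, hr, hΛ, ?_⟩
  simpa only [mul_one, torusGen] using hB

/-- `n ≤ dc(per_n)` (degree bound). [cite: MignonRessayre2004, §1] -/
theorem le_determinantalComplexity_perPoly (n : ℕ) : n ≤ determinantalComplexity (perPoly (Fin n) ℂ) := by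
  have h1 := totalDegree_le_of_hasDetRepr_holds (k := ℂ) (σ := Fin n × Fin n)
    (hasDetRepr_determinantalComplexity_holds (perPoly (Fin n) ℂ))
  have h2 : (perPoly (Fin n) ℂ).totalDegree = n := by
    rw [totalDegree_perPoly_holds (n := Fin n) (k := ℂ), Fintype.card_fin]
  rw [h2] at h1
  exact h1

/-- **Relaxed target + numeric rung ⇒ VH**: for large `n`, an optimal expression `A` of `per_n`
(`hasDetRepr_determinantalComplexity_holds`) is re-realised equivariantly as a representation of a multiple
`per_n · q` (`deg q ≤ δ`) of size `≤ dc(per_n) + δ` with `r ≤ ⌊n/2⌋`; the rung gives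
`C(n,⌊n/2⌋) ≤ (δ+1) · (dc(per_n) + δ) · 2^{⌊n/2⌋} ≤ n · dc(per_n) · 2^{⌊n/2⌋}` (`n ≥ (δ + 1)²`, `dc ≥ 1`);
`vh_of_eventual_linear_loss` concludes. [cite: LandsbergRessayre2017, Question 2.2] [cite: Burgisser2000, Thm. 2.10] -/
theorem closes_multiple {δ : ℕ} (h₁ : OrbitMultipleBound δ) (h₂ : MultipleCovering δ) : _root_.ValiantsHypothesis := by
  obtain ⟨n₀, h₁⟩ := h₁
  refine Power.vh_of_eventual_linear_loss (max n₀ ((δ + 1) ^ 2 + 3)) fun n hn => ?_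
  have hn₀ : n₀ ≤ n := le_trans (le_max_left _ _) hn
  have hnδ : (δ + 1) ^ 2 + 3 ≤ n := le_trans (le_max_right _ _) hn
  have hn3 : 3 ≤ n := by omega
  obtain ⟨A, hA⟩ := hasDetRepr_determinantalComplexity_holds (perPoly (Fin n) ℂ)
  obtain ⟨m', B, q, r, Λ, hm', hq0, hqd, hr, hΛ, hB⟩ := h₁ n hn₀ _ A hA
  set D : ℕ := determinantalComplexity (perPoly (Fin n) ℂ) with hD
  have hD1 : 1 ≤ D := le_trans (by omega) (le_determinantalComplexity_perPoly n)
  have hcov : n.choose (n / 2) ≤ (δ + 1) * (m' * 2 ^ r) := h₂ n hn3 m' r Λ B q hΛ hq0 hqd hB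
  have h2r : 2 ^ r ≤ 2 ^ (n / 2) := Nat.pow_le_pow_right (by norm_num) hr
  have hm'' : (δ + 1) * m' ≤ n * D := by
    calc (δ + 1) * m' ≤ (δ + 1) * (D + δ) := Nat.mul_le_mul_left _ hm'
      _ ≤ (δ + 1) * (D + δ * D) := by gcongr; nlinarith
      _ = (δ + 1) ^ 2 * D := by ring
      _ ≤ n * D := Nat.mul_le_mul_right _ (by omega)
  calc n.choose (n / 2) ≤ (δ + 1) * (m' * 2 ^ r) := hcov
    _ = ((δ + 1) * m') * 2 ^ r := by ring
    _ ≤ (n * D) * 2 ^ (n / 2) := by gcongr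
    _ = n * (D * 2 ^ (n / 2)) := by ring

/-- **Rung pair closes VH**: `OrbitMultipleBound 1 → AffineMultipleCovering → VH`. [cite: LandsbergRessayre2017, Question 2.2] -/
theorem closes_affineMultiple (h₁ : OrbitMultipleBound 1) (h₂ : AffineMultipleCovering) : _root_.ValiantsHypothesis :=
  closes_multiple h₁ h₂

/-- The rung also closes the host route with its ORIGINAL crux (`OrbitDimensionBound → AffineMultipleCovering → VH`).
[cite: LandsbergRessayre2017, Question 2.2] -/
theorem closes_of_orbitDimensionBound
    (h₁ : Summit.ValiantsHypothesis.ValiantsHypothesis.Theses.FreeSubtorus.OrbitDimensionBound)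
    (h₂ : AffineMultipleCovering) : _root_.ValiantsHypothesis :=
  closes_affineMultiple (orbitMultipleBound_of_orbitDimensionBound 1 h₁) h₂

end

end Summit.ValiantsHypothesis.ValiantsHypothesis.Cruxes.OrbitDimensionBound.Multiple
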